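import Summits.CriticalPhenomena.SAWScalingLimit.Theses.SAWWeldingIdentification

/-!
# `IdentifyFromWeldingAE` (route `SAWWeldingIdentification`, item stmt-CriticalPhenomena-11091)

Identification of a probability measure `P` on curve classes with the law `μ = ν.map Γ` of a random
curve `Γ` from the law of a separating countable family of Borel functionals (the welding values
`γ ↦ W Q γ q`, `q ∈ ℚ₊`), in the INNER (a.e. on the probability space of `Γ`) form consumed by the
route's deciding theorem `closes`.

**Proof** (one-sided Lusin–Souslin; no measurability of the removable-chord set is needed).
* `measure_eq_map_of_injOn_of_map_eq` — abstract form: `X` standard Borel, `V : X → (ι → ℝ)` measurable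
  (`ι` countable), `good : X → Prop` with `P`-a.e. `good`, `ν`-a.e. `good ∘ Γ`, `V` injective on `good`,
  and `P.map V = (ν.map Γ).map V`. Pick a Borel `P`-null set `N ⊇ {¬ good}`; for Borel `A` the set
  `V '' (A \ N)` is Borel (Lusin–Souslin, `MeasurableSet.image_of_measurable_injOn`), so
  `P A = P (A \ N) ≤ (P.map V) (V '' (A \ N)) = ((ν.map Γ).map V) (V '' (A \ N))
  = ν (Γ⁻¹ V⁻¹ V(A \ N)) ≤ ν (Γ⁻¹ A ∪ {¬ good ∘ Γ}) ≤ (ν.map Γ) A`; thus `P ≤ ν.map Γ` on Borel sets and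
  two probability measures with `P ≤ μ` are equal (`Measure.eq_of_le_of_isProbabilityMeasure`).
* `map_eq_of_marginals` — the laws of `V γ := (q ↦ W Q γ q)` under `P` and `μ` agree as soon as all
  `Fin k`-indexed marginals at positive rationals agree (`IsProjectiveLimit.unique`, reindexing a
  `Finset` of `ℚ₊` through `Finset.equivFin`).
* `identifyFromWeldingAE_proof` — the route decl, by instantiating `X = CurveClass ℂ` (Polish, hence
  standard Borel), `ι = {q : ℚ // 0 < q}`.

Sources: classical (Lusin–Souslin theorem, Kechris *Classical Descriptive Set Theory* Thm 15.1;
Billingsley 1999 §1 π–λ uniqueness). No named facts are used.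
-/

open MeasureTheory Set Filter Function
open Literature.Probability.RandomPlanarGeometry

namespace Summit.CriticalPhenomena.SAWScalingLimit.Theorems

namespace IdentifyFromWeldingAE

/-- **One-sided Lusin–Souslin identification.** Let `X` be a standard Borel space, `ι` countable,
`V : X → (ι → ℝ)` measurable and injective on a property `good`, `P` a probability measure on `X` with
`P`-a.e. `good`, and `Γ : Ω → X` an a.e.-measurable random element of a measure space `(Ω, ν)` whose law
`ν.map Γ` is a probability measure, with `good (Γ ω)` for `ν`-a.e. `ω`. If the laws of `V` under `P` and
`ν.map Γ` coincide, then `P = ν.map Γ`. The point is that `good` need not be measurable: only a Borel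
subset of full `P`-measure is pushed through Lusin–Souslin, which yields `P ≤ ν.map Γ`, and equality of
total masses finishes. [folklore] -/
theorem measure_eq_map_of_injOn_of_map_eq
    {X : Type*} [MeasurableSpace X] [StandardBorelSpace X]
    {Ω : Type*} [MeasurableSpace Ω] {ι : Type*} [Countable ι]
    (P : Measure X) (ν : Measure Ω) (Γ : Ω → X) [IsProbabilityMeasure P]
    [IsProbabilityMeasure (ν.map Γ)] (hΓ : AEMeasurable Γ ν)
    (good : X → Prop) (V : X → ι → ℝ) (hV : Measurable V)
    (hP : ∀ᵐ γ ∂P, good γ) (hν : ∀ᵐ ω ∂ν, good (Γ ω))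
    (hinj : ∀ γ γ', good γ → good γ' → V γ = V γ' → γ = γ')
    (hlaw : P.map V = (ν.map Γ).map V) :
    P = ν.map Γ := by
  -- a Borel `P`-null set containing the bad curves
  obtain ⟨N, hNsub, hNmeas, hN0⟩ := exists_measurable_superset_of_null (ae_iff.1 hP)
  have hgood : ∀ γ, γ ∉ N → good γ := fun γ hγ => by
    by_contra h
    exact hγ (hNsub h)
  refine Measure.eq_of_le_of_isProbabilityMeasure (Measure.le_iff.2 fun A hA => ?_)
  -- Lusin–Souslin: the image of the Borel set `A \ N` under the measurable injection `V` is Borel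
  have hS : MeasurableSet (V '' (A \ N)) :=
    (hA.diff hNmeas).image_of_measurable_injOn hV fun γ hγ γ' hγ' h =>
      hinj γ γ' (hgood γ hγ.2) (hgood γ' hγ'.2) h
  calc P A = P (A \ N) := (measure_sdiff_null hN0).symm
    _ ≤ P (V ⁻¹' (V '' (A \ N))) := measure_mono (subset_preimage_image V (A \ N))
    _ = (P.map V) (V '' (A \ N)) := (Measure.map_apply hV hS).symm
    _ = ((ν.map Γ).map V) (V '' (A \ N)) := by rw [hlaw]
    _ = (ν.map Γ) (V ⁻¹' (V '' (A \ N))) := Measure.map_apply hV hS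
    _ = ν (Γ ⁻¹' (V ⁻¹' (V '' (A \ N)))) := Measure.map_apply_of_aemeasurable hΓ (hV hS)
    _ ≤ ν (Γ ⁻¹' A ∪ {ω | ¬ good (Γ ω)}) := by
        refine measure_mono fun ω hω => ?_
        obtain ⟨γ', hγ', hEq⟩ := hω
        by_cases hg : good (Γ ω)
        · left
          rw [mem_preimage, ← hinj γ' (Γ ω) (hgood γ' hγ'.2) hg hEq]
          exact hγ'.1
        · exact Or.inr hg
    _ ≤ ν (Γ ⁻¹' A) + ν {ω | ¬ good (Γ ω)} := measure_union_le _ _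
    _ = ν (Γ ⁻¹' A) := by rw [ae_iff.1 hν, add_zero]
    _ = (ν.map Γ) A := (Measure.map_apply_of_aemeasurable hΓ hA).symm

/-- **Finite-dimensional marginals determine the law of a countable family.** If `W : X → ℝ → ℝ` is
measurable in its first argument and two finite measures `P`, `μ` on `X` give the same law to
`γ ↦ (W γ (x i))_{i < k}` for every `k` and every `x : Fin k → ℚ` with positive entries, then the laws of
the whole positive-rational family `γ ↦ (q ↦ W γ q)`, `q ∈ {q : ℚ // 0 < q}`, agree (uniqueness of
projective limits, `IsProjectiveLimit.unique`, i.e. the π-system of cylinders). [folklore] -/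
theorem map_eq_of_marginals {X : Type*} [MeasurableSpace X]
    (P μ : Measure X) [IsFiniteMeasure P] (W : X → ℝ → ℝ)
    (hW : ∀ x : ℝ, Measurable fun γ => W γ x)
    (hmarg : ∀ (k : ℕ) (x : Fin k → ℚ), (∀ i, 0 < x i) →
      P.map (fun γ i => W γ (x i)) = μ.map (fun γ i => W γ (x i))) :
    P.map (fun γ (q : {q : ℚ // 0 < q}) => W γ (q.1 : ℝ)) =
      μ.map (fun γ (q : {q : ℚ // 0 < q}) => W γ (q.1 : ℝ)) := by
  set V : X → {q : ℚ // 0 < q} → ℝ := fun γ q => W γ (q.1 : ℝ)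
  have hV : Measurable V := measurable_pi_lambda _ fun q => hW _
  refine IsProjectiveLimit.unique
    (P := fun I : Finset {q : ℚ // 0 < q} => (P.map V).map I.restrict) (fun I => rfl) fun I => ?_
  -- goal: `((μ.map V).map I.restrict) = (P.map V).map I.restrict`; reindex `I` by `Fin I.card`
  have hres : Measurable (I.restrict (π := fun _ : {q : ℚ // 0 < q} => ℝ)) :=
    Finset.measurable_restrict _
  set e := I.equivFin
  obtain ⟨x, hx, hxdef⟩ : ∃ x : Fin I.card → ℚ, (∀ i, 0 < x i) ∧
      ∀ i, x i = ((e.symm i : I) : {q : ℚ // 0 < q}).1 :=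
    ⟨fun i => ((e.symm i : I) : {q : ℚ // 0 < q}).1,
      fun i => ((e.symm i : I) : {q : ℚ // 0 < q}).2, fun _ => rfl⟩
  have hg : Measurable fun (g : Fin I.card → ℝ) (j : I) => g (e j) :=
    measurable_pi_lambda _ fun j => measurable_pi_apply _
  have hf : Measurable fun γ (i : Fin I.card) => W γ (x i) :=
    measurable_pi_lambda _ fun i => hW _
  have hfac : I.restrict (π := fun _ : {q : ℚ // 0 < q} => ℝ) ∘ V =
      (fun (g : Fin I.card → ℝ) (j : I) => g (e j)) ∘ fun γ (i : Fin I.card) => W γ (x i) := by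
    funext γ j
    show W γ ((j : {q : ℚ // 0 < q}).1 : ℝ) = W γ (x (e j))
    rw [hxdef (e j), Equiv.symm_apply_apply]
  change (μ.map V).map (I.restrict (π := fun _ : {q : ℚ // 0 < q} => ℝ)) =
    (P.map V).map (I.restrict (π := fun _ : {q : ℚ // 0 < q} => ℝ))
  rw [Measure.map_map hres hV, Measure.map_map hres hV, hfac, ← Measure.map_map hg hf,
    ← Measure.map_map hg hf, hmarg _ x hx]

end IdentifyFromWeldingAE

/-- **Item stmt-CriticalPhenomena-11091 (`IdentifyFromWeldingAE`)**: identification from the welding law,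
inner (Wiener-space a.e.) form. For a conformal rectangle `Q`, a welding functional `W` (Borel in `γ`),
a probability measure `P` on `CurveClass ℂ` and an a.e.-measurable random curve `Γ` on the Wiener space
with law `μ = preWienerMeasure.map Γ` a probability measure: if `P`-a.e. curve and a.e. `Γ ω` are
removable simple chords of `Q.chord 0 2`, `W` separates removable simple chords through its values at
positive rationals, and all finite-dimensional `W`-marginals of `P` and `μ` at positive rational points
agree, then `P = μ`. One-sided Lusin–Souslin (`IdentifyFromWeldingAE.measure_eq_map_of_injOn_of_map_eq`)
on the Polish space `CurveClass ℂ`. [folklore] -/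
theorem identifyFromWeldingAE_proof :
    Summit.CriticalPhenomena.SAWScalingLimit.Theses.SAWWeldingIdentification.IdentifyFromWeldingAE := by
  unfold Summit.CriticalPhenomena.SAWScalingLimit.Theses.SAWWeldingIdentification.IdentifyFromWeldingAE
  intro Q W P Γ hP hμ hΓ hWmeas hPgood hνgood hinj hmarg
  refine IdentifyFromWeldingAE.measure_eq_map_of_injOn_of_map_eq P
    Literature.Probability.Process.preWienerMeasure Γ hΓ _
    (fun γ (q : {q : ℚ // 0 < q}) => W Q γ (q.1 : ℝ))
    (measurable_pi_lambda _ fun q => hWmeas Q _) hPgood hνgood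
    (fun γ γ' hγ hγ' hEq => hinj γ γ' hγ hγ' fun q hq => ?_)
    (IdentifyFromWeldingAE.map_eq_of_marginals P _ (W Q) (hWmeas Q) hmarg)
  exact congr_fun hEq ⟨q, hq⟩

end Summit.CriticalPhenomena.SAWScalingLimit.Theorems
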